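/-
Copyright: fleet lead `ym-wcr-19609-p1` (seat prover-ym-wcr-19609-p1-g0-0), route `WeakCouplingRates`, crux
`BulkDominatesColdBoxW` (stmt-QuantumFields-19609).
-/
import Summits.QuantumFields.YangMills.Theorems.WeakCouplingRates
import Summits.QuantumFields.YangMills.Theorems.WeakCouplingRatesDefs

/-!
# Route `WeakCouplingRates` — posited objects of the BULK split (line `dlr-chessboard` of crux `BulkDominatesColdBoxW`):
# the DLR–chessboard predicates `PlaquetteLargeFieldRarity`, `CrudeGood`, `GoodBoundaryCovStable`,
# `GoodBoundaryMeanSmooth`, `BoxPolyFloor`, `DlrAssembly` and the box kernel `boxKernel`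

The crux `Summit.QuantumFields.YangMills.Theses.WeakCouplingRates.BulkDominatesColdBoxW` (BULK_W, rev 2: for every
`θ₀ > 0` there are exponents `0 < A < θ ≤ θ₀` with `BulkDominatesBox A θ` — eventually in the torus size `L`, the torus-state
covariance of the `(1,2)`-plaquette cost and its time-translate by `⌈β^A⌉` is `≥ η ×` the same covariance in the cold-wall Wilson
box of side `2⌈β^θ⌉+1`) is split by its registered line skeleton (`Cruxes/BulkDominatesColdBoxW/Lines/dlr-chessboard.lean`,
planner ym-beyond-p3 g13, v2, sha16 `021c654069d76526`, item evidence #1 on stmt-QuantumFields-19609) into five stubs over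
SIX posited predicates and one abbreviation.  This file types them over tree declarations only, BYTE-FOR-BYTE the bodies of
the registered skeleton (so that every stub of the line can be landed BY NAME + SIGNATURE against tree objects, and the lead's
reshaped skeleton imports this module instead of re-declaring them):

* `PlaquetteLargeFieldRarity δ` (input L2) — volume-uniform large-field rarity of ONE plaquette of the `SU(2)₄` torus states:
  `∃ β₀, ∀ β ≥ β₀, ∀ᶠ L, ∀ x, ∀ i < j, wilsonExpectation_{(L+1)⁴} 𝟙{β^{2δ−1} ≤ plaqCostAt ρ x i j} ≤ exp(−β^δ)`
  (PROVED for every `δ > 0`: `plaquetteLargeFieldRarity_eventually`, module `WeakCouplingRatesLargeFieldTailAllSides`);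
* `boxKernel β H ω` — the DLR box kernel `ymSpecification ρ β (boxEdges 4 (2H+1)) ω` of the cube `[0,2H]⁴` (`ω ≡ 1` is the
  leaf's `boxState`);
* `CrudeGood β δ H ω` — «crude-good» boundary datum: every plaquette of `ω` based in the corona range `[−1, 2H+1]⁴` has cost
  `≤ β^{2δ−1}` (`≤ 6(2H+3)⁴` plaquettes, independently of the torus size);
* `GoodBoundaryCovStable A θ δ η₁` (input L1a, load-bearing) — for crude-good `ω` the box-kernel covariance of the two central
  plaquette costs at separation `⌈β^A⌉` is `≥ η₁ ×` the cold-wall one (`boxPlaqCov`), `H = ⌈β^θ⌉`;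
* `GoodBoundaryMeanSmooth A θ δ` (input L1b) — for crude-good `ω` the two conditional means differ by `≤ K β^{2δ−1} ⌈β^A⌉/⌈β^θ⌉`;
* `BoxPolyFloor A θ K` — the cold-wall covariance is eventually `≥ β^{−K}` (a consequence of the route's BOX_W + FLOOR);
* `DlrAssembly` (input L3) — the DLR law of total covariance: on the window `K + 4δ + 2A < 2 + 2θ` the four inputs give
  `BulkDominatesBox A θ`.

Design notes.  (1) Everything is typed for `G = SU(2)`, fundamental Wilson action, `d = 4`, exactly as the crux.  (2) The
predicates are the LINE's posits, not claims: L1a/L1b/L3 are open stubs; typing them here asserts nothing.  (3) Namespace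
`Summit.QuantumFields.YangMills.Theorems.WeakCouplingRates` (the leaf module's), so that the skeleton's
`open Summit.QuantumFields.YangMills.Theorems.WeakCouplingRates` resolves the short names verbatim.
No theorem of substance here: two `rfl` lemmas only.  NOT a claim about the mass gap.
-/

set_option autoImplicit false

noncomputable section

open MeasureTheory Filter Topology
open Literature.MathematicalPhysics Literature.MathematicalPhysics.QuantumFieldTheory
open Literature.MathematicalPhysics.QuantumLattice

namespace Summit.QuantumFields.YangMills.Theorems.WeakCouplingRates

/-- **L2 (first lemma) — volume-uniform large-field rarity of one plaquette**, SU(2), `d = 4`: for `β ≥ β₀` and all large tori,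
`μ_{L+1,β}(c_p ≥ β^{2δ-1}) ≤ exp(−β^δ)` for EVERY plaquette `p = (x; i<j)` (cost `c_p = 2 − tr U_p`; all sites and planes, as the union bound of L3
needs).  Route to it: reflection positivity (link planes on even sides, the mixed site/link reflection on odd sides) ⇒ chessboard estimate ⇒
`μ(c_p ≥ t²) ≤ e^{−β t²/2}·(crude partition-function ratio)^{O(1)/L⁴}`.  PROVED for every `δ > 0`
(`plaquetteLargeFieldRarity_eventually`; Fröhlich–Israel–Lieb–Simon 1978 Thm. 4.1 for the chessboard estimate).  A predicate posited by the
line, not a literature fact. -/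
def PlaquetteLargeFieldRarity (δ : ℝ) : Prop :=
  ∃ β₀ : ℝ, ∀ β : ℝ, β₀ ≤ β → ∀ᶠ L : ℕ in atTop, ∀ (x : Literature.Probability.LatticeModels.Site 4) (i j : Fin 4), i < j →
    wilsonExpectation (L := L + 1) (fundamentalRep (Fin 2)) β
        (toTorusObservable (L + 1) fun U : LGConfig 4 (Matrix.specialUnitaryGroup (Fin 2) ℂ) =>
          if β ^ (2 * δ - 1) ≤ plaqCostAt (fundamentalRep (Fin 2)) x i j U then (1 : ℝ) else 0)
      ≤ Real.exp (-(β ^ δ))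

/-- Shorthand: the DLR box kernel of the cube `[0, 2H]⁴` with boundary datum `ω` (the tree's `ymSpecification`; `ω ≡ 1` is `boxState`);
route-posited plumbing object. -/
def boxKernel (β : ℝ) (H : ℕ) (ω : LGConfig 4 (Matrix.specialUnitaryGroup (Fin 2) ℂ)) :
    Measure (LGConfig 4 (Matrix.specialUnitaryGroup (Fin 2) ℂ)) :=
  ymSpecification (d := 4) (fundamentalRep (Fin 2)) β (AxialGauge.boxEdges 4 (2 * H + 1)) ω

/-- The box kernel with the flat datum is the leaf's cold-wall box state `boxState`. [folklore] -/
theorem boxKernel_one (β : ℝ) (H : ℕ) :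
    boxKernel β H (fun _ => 1) = boxState (fundamentalRep (Fin 2)) β H := rfl

/-- «crude-good» boundary datum at scale `β^{2δ-1}` FOR THE BOX `[0, 2H]⁴`: every plaquette of `ω` based in the corona range `[-1, 2H+1]⁴`
(this contains every plaquette the kernel `ymSpecification … (boxEdges 4 (2H+1)) ω` depends on) has cost at most `β^{2δ-1}`.  The range is bounded by
`6 (2H+3)⁴` plaquettes INDEPENDENTLY of the torus size — this is what makes the union bound in L3 uniform in `L` (a condition on all plaquettes of the
torus would have probability → 0 as `L → ∞`).  A predicate posited by the line. -/
def CrudeGood (β δ : ℝ) (H : ℕ) (ω : LGConfig 4 (Matrix.specialUnitaryGroup (Fin 2) ℂ)) : Prop :=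
  ∀ (x : Literature.Probability.LatticeModels.Site 4), (∀ k : Fin 4, (-1 : ℤ) ≤ x k ∧ x k ≤ 2 * (H : ℤ) + 1) →
    ∀ (i j : Fin 4), i < j → plaqCostAt (fundamentalRep (Fin 2)) x i j ω ≤ β ^ (2 * δ - 1)

/-- The flat datum is crude-good whenever the threshold is non-negative (every plaquette cost of `ω ≡ 1` is `0`). [folklore] -/
theorem crudeGood_one {β δ : ℝ} (hβ : 0 ≤ β) (H : ℕ) : CrudeGood β δ H (fun _ => 1) := by
  intro x _ i j _
  have h0 : plaqCostAt (fundamentalRep (Fin 2)) x i j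
      (fun _ : QuantumLattice.ZdEdge 4 => (1 : Matrix.specialUnitaryGroup (Fin 2) ℂ)) = 0 := by
    simp only [plaqCostAt, plaquetteObs, plaquetteHolonomyZd, mul_one, inv_one, map_one, Matrix.trace_one,
      Fintype.card_fin, Complex.natCast_re]
    norm_num
  rw [h0]
  exact Real.rpow_nonneg hβ _

/-- **L1a (finite volume, uniform over small boundary data) — deep covariances of the DLR box kernel are stable**: for boundary data `ω`
all of whose plaquettes in the corona range of the box have cost `≤ β^{2δ-1}` (`CrudeGood`), the box kernel `γ_Λ(·|ω) = ymSpecification ρ β Λ_H ω` has central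
plaquette-cost covariance at separation `T = ⌈β^A⌉` at least `η₁ ×` the cold-wall one (`ω ≡ 1`), for `H = ⌈β^θ⌉`.  A POSIT of the line (open stub
`stub_goodBoundaryCovStable`), not a claim and not a literature fact. -/
def GoodBoundaryCovStable (A θ δ η₁ : ℝ) : Prop :=
  ∃ β₀ : ℝ, ∀ β : ℝ, β₀ ≤ β → ∀ ω : LGConfig 4 (Matrix.specialUnitaryGroup (Fin 2) ℂ),
    CrudeGood β δ ⌈β ^ θ⌉₊ ω →
      η₁ * boxPlaqCov (fundamentalRep (Fin 2)) β ⌈β ^ θ⌉₊ ⌈β ^ A⌉₊ ≤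
        (∫ U, plaqCostAt (fundamentalRep (Fin 2)) (boxCentre ⌈β ^ θ⌉₊) 1 2 U *
              plaqCostAt (fundamentalRep (Fin 2)) (boxCentre ⌈β ^ θ⌉₊ + Pi.single 0 (⌈β ^ A⌉₊ : ℤ)) 1 2 U
            ∂(ymSpecification (d := 4) (fundamentalRep (Fin 2)) β (AxialGauge.boxEdges 4 (2 * ⌈β ^ θ⌉₊ + 1)) ω)) -
          (∫ U, plaqCostAt (fundamentalRep (Fin 2)) (boxCentre ⌈β ^ θ⌉₊) 1 2 U
              ∂(ymSpecification (d := 4) (fundamentalRep (Fin 2)) β (AxialGauge.boxEdges 4 (2 * ⌈β ^ θ⌉₊ + 1)) ω)) *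
            (∫ U, plaqCostAt (fundamentalRep (Fin 2)) (boxCentre ⌈β ^ θ⌉₊ + Pi.single 0 (⌈β ^ A⌉₊ : ℤ)) 1 2 U
              ∂(ymSpecification (d := 4) (fundamentalRep (Fin 2)) β (AxialGauge.boxEdges 4 (2 * ⌈β ^ θ⌉₊ + 1)) ω))

/-- **L1b — deep conditional MEANS are position-smooth**: for every crude-good `ω` (this includes the cold wall `ω ≡ 1`, cost `0`) the conditional
mean of the plaquette cost changes by at most `K β^{2δ-1} T/H` between the centre plaquette and its translate by `T = ⌈β^A⌉` (`H = ⌈β^θ⌉`): the background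
extending `ω` has curvature `≤ β^{δ-1/2}` and gradient `≲ β^{δ-1/2}/H` at depth `H` (elliptic regularity of the variational problem with small Dirichlet
data, cf. Bałaban CMP 102 (1985)).  A POSIT of the line (open stub `stub_goodBoundaryMeanSmooth`), not a claim and not a literature fact. -/
def GoodBoundaryMeanSmooth (A θ δ : ℝ) : Prop :=
  ∃ K : ℝ, ∃ β₀ : ℝ, ∀ β : ℝ, β₀ ≤ β → ∀ ω : LGConfig 4 (Matrix.specialUnitaryGroup (Fin 2) ℂ), CrudeGood β δ ⌈β ^ θ⌉₊ ω →
    |(∫ U, plaqCostAt (fundamentalRep (Fin 2)) (boxCentre ⌈β ^ θ⌉₊ + Pi.single 0 (⌈β ^ A⌉₊ : ℤ)) 1 2 U ∂(boxKernel β ⌈β ^ θ⌉₊ ω)) -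
        (∫ U, plaqCostAt (fundamentalRep (Fin 2)) (boxCentre ⌈β ^ θ⌉₊) 1 2 U ∂(boxKernel β ⌈β ^ θ⌉₊ ω))|
      ≤ K * β ^ (2 * δ - 1) * (⌈β ^ A⌉₊ : ℝ) / (⌈β ^ θ⌉₊ : ℝ)

/-- **Polynomial box floor** (much weaker than crux BOX + FLOOR, which give exponent `2 + 8A`): the cold-wall covariance is eventually `≥ β^{-K}`.
A predicate posited by the line (= the route's BOX_W + FLOOR + arithmetic along the family). -/
def BoxPolyFloor (A θ K : ℝ) : Prop :=
  ∃ β₀ : ℝ, ∀ β : ℝ, β₀ ≤ β → β ^ (-K) ≤ boxPlaqCov (fundamentalRep (Fin 2)) β ⌈β ^ θ⌉₊ ⌈β ^ A⌉₊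

/-- **L3 — the DLR assembly** (law of total covariance for the torus state conditioned on the complement of the box, `Cov(X,Y) ≥ −¼ Var(Y−X)` for the
conditional-mean term, good/bad split of the boundary datum (`CrudeGood β δ H`) with `|c| ≤ 4`, union bound over the `≤ 6(2H+3)⁴` corona plaquettes (uniform in `L`) using L2, translation
invariance of the torus state, and the DLR consistency of the torus Wilson measure with the box kernel — the torus side `L+1 ≥ 4H+6` so that box + corona
do not wrap): when `K + 4δ + 2A < 2 + 2θ` (the `¼Var` term `≤ ¼K²β^{4δ-2}T²/H²` is then `o(β^{-K})`) the four inputs give BULK as typed with `η = η₁/2`.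
Probability + DLR plumbing, no analysis.  A POSIT of the line (open stub `stub_dlrAssembly`), not a claim and not a literature fact: a
parameterless `Prop` naming the line's composition step, to be PROVED in `Theorems/` (never a named fact). -/
def DlrAssembly : Prop :=
  ∀ A θ δ η₁ K : ℝ, 0 < A → 0 < δ → 0 < η₁ → K + 4 * δ + 2 * A < 2 + 2 * θ →
    GoodBoundaryCovStable A θ δ η₁ → GoodBoundaryMeanSmooth A θ δ → PlaquetteLargeFieldRarity δ → BoxPolyFloor A θ K →
      BulkDominatesBox (G := Matrix.specialUnitaryGroup (Fin 2) ℂ) (fundamentalRep (Fin 2)) A θ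


/-! ## Appended 2026-08-26 (lead seat g2, census v3 = item evidence #12): the two INTERFACES of stub L1b `stub_goodBoundaryMeanSmooth`

Census v3 of the line: the box kernel with a crude-good datum linearises around the FLAT configuration; the datum enters only as the mean
shift `LatticeMaxwell.mean` of the temporal-gauge Dirichlet Gaussian `boxDirichlet H` (D1', `Theorems/WeakCouplingRatesDefs.lean`), whose
background circulation `F̄ = sCirc (glue ϑ (mean ϑ))` has harmonic components with interior bounds from its energy
(`Theorems/WeakCouplingRatesBulkDominatesColdBoxWDatumBackground*.lean`).  L1b then splits into the two predicates below (POSITS of the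
line — open sub-stubs — typed here so that they can be proved BY NAME; the kernel-checked reduction
`L1b ⇐ KernelMeanExpansion ∧ DirKernelDiagFlat` is `Theorems/WeakCouplingRatesBulkDominatesColdBoxWMeanSmoothOfExpansion.lean`). -/

/-- **Interface N2 (mean form) — the one-scale expansion of deep kernel MEANS, uniformly over crude-good data.**  For `β ≥ β₀` and every
crude-good datum `ω` (scale `β^{2δ-1}`, box `H = ⌈β^θ⌉`) there are one-colour Dirichlet data `ϑ c` (c < 3; in the proof: the chart
coordinates of the exterior collar links of a small gauge copy of `ω`, `0` on the forest) and free competitors `s c` (the chart coordinates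
of the forest-gauged copy inside) of total Maxwell energy `Σ_c M_{ϑ c}(s c) ≤ 16(2H+3)⁴β^{2δ-1}`, such that at EVERY base point `x` within
`H/8` of the centre (sup norm) the kernel mean of the `(1,2)`-plaquette cost is the Gaussian value up to `β^{-θ}`:
`|β·E_ω[c_{(x;1,2)}] − (3/2)·V_D(x;1,2) − β·Σ_c F̄_c(x;1,2)²| ≤ β^{-θ}`, `V_D = boxDirProjKernel H q q` (the D1' variance, the same for all
three colours), `F̄_c = sCirc (glue (ϑ c) (mean (ϑ c)))` the background circulation of the datum.  Content: forest gauge with datum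
(`integral_ymSpecification_box_eq_coldFree`), large fields (`boxKernel_largeField_rarity_crudeGood`), Poincaré with small exterior
(`ell_le_uniform_of_exterior_le`), gnomonic chart + cubic remainder, tilt `o(1)` for small `θ`, mean shift (`lintegral_mul_wθ_dir_div_eq`),
Wick.  A POSIT of the line (open), not a claim and not a literature fact. -/
def KernelMeanExpansion (θ δ : ℝ) : Prop :=
  ∃ β₀ : ℝ, ∀ β : ℝ, β₀ ≤ β → ∀ ω : LGConfig 4 (Matrix.specialUnitaryGroup (Fin 2) ℂ), CrudeGood β δ ⌈β ^ θ⌉₊ ω →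
    ∃ ϑ : Fin 3 → (Literature.MathematicalPhysics.QuantumLattice.ZdEdge 4 → ℝ), ∃ s : Fin 3 → (DirFree ⌈β ^ θ⌉₊ → ℝ),
      (∑ c, LatticeMaxwell.formM (fun e => e ∉ dirFreeEdges ⌈β ^ θ⌉₊) dirCorner (2 * ⌈β ^ θ⌉₊ + 3) (ϑ c) (s c) ≤
          16 * (2 * (⌈β ^ θ⌉₊ : ℝ) + 3) ^ 4 * β ^ (2 * δ - 1)) ∧
      ∀ x : Literature.Probability.LatticeModels.Site 4,
        (∀ m : Fin 4, 8 * |x m - (⌈β ^ θ⌉₊ : ℤ)| ≤ (⌈β ^ θ⌉₊ : ℤ)) →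
          |β * (∫ U, plaqCostAt (fundamentalRep (Fin 2)) x 1 2 U ∂(boxKernel β ⌈β ^ θ⌉₊ ω)) -
              3 / 2 * boxDirProjKernel ⌈β ^ θ⌉₊ (x, 1, 2) (x, 1, 2) -
              β * ∑ c, LatticeMaxwell.sCirc (LatticeMaxwell.glue (pin := fun e => e ∉ dirFreeEdges ⌈β ^ θ⌉₊) dirCorner (2 * ⌈β ^ θ⌉₊ + 3)
                (ϑ c) (LatticeMaxwell.mean (fun e => e ∉ dirFreeEdges ⌈β ^ θ⌉₊) dirCorner (2 * ⌈β ^ θ⌉₊ + 3) (ϑ c)))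
                  (x, 1, 2) ^ 2| ≤ β ^ (-θ)

/-- **Interface N1' — the Dirichlet plaquette variance is FLAT near the centre of the cold box.**  There are `K` and `H₀` such that for
`H ≥ H₀` and any two base points `x, x'` within `H/8` of the centre (sup norm), the D1' variances of the `(1,2)`-circulations differ by at
most `K/H`: `|V_D(x;1,2) − V_D(x';1,2)| ≤ K/H`, `V_D q = boxDirProjKernel H q q`.  A consequence (with the much better rate `H⁻⁴`) of the
Dirichlet twin of `exists_boxProjKernel_sub_curl_bound` (both variances are within `K/H⁴` of the translation-invariant `ℤ⁴` curvature
kernel at coincident points); stated in the weak form L1b consumes.  A POSIT of the line (open), not a claim and not a literature fact. -/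
def DirKernelDiagFlat : Prop :=
  ∃ K : ℝ, ∃ H₀ : ℕ, ∀ H : ℕ, H₀ ≤ H → ∀ x x' : Literature.Probability.LatticeModels.Site 4,
    (∀ m : Fin 4, 8 * |x m - (H : ℤ)| ≤ (H : ℤ)) → (∀ m : Fin 4, 8 * |x' m - (H : ℤ)| ≤ (H : ℤ)) →
      |boxDirProjKernel H (x, 1, 2) (x, 1, 2) - boxDirProjKernel H (x', 1, 2) (x', 1, 2)| ≤ K / H


/-! ## Appended 2026-08-26 (lead seat g2, census v3): the three INTERFACES of stub L1a `stub_goodBoundaryCovStable`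

L1a (`Cov_ω ≥ η₁·Cov_1` at the pair `p = (centre; 1,2)`, `q = p + T e₀`, `T = ⌈β^A⌉`) splits into: the one-scale expansion of the deep
kernel COVARIANCE uniformly over crude-good data (Gaussian value `(3/2)·C_D(p,q)² + 2β⟨F̄_p, F̄_q⟩·C_D(p,q)`, error `β^{−θ/2}`); the same
expansion for the FLAT datum with NO background (= the sibling crux's S3c in its Dirichlet form, `|β²·Cov_1 − (3/2)C_D²| ≤ β^{−θ/2}`); and the
size of the Dirichlet two-point kernel at depth `T ≪ H` (`κ′/T⁴ ≤ C_D(p,q) ≤ 1`, = Dirichlet-vs-`ℤ⁴` comparison + FLOOR).  The reduction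
`L1a ⇐ the three` (polarisation `2⟨F̄_p,F̄_q⟩ ≥ −|F̄_p − F̄_q|²` + the interior GRADIENT bound, ratio `β^{−1.3θ}`) is
`Theorems/WeakCouplingRatesBulkDominatesColdBoxWCovStableOfExpansion.lean`.  POSITS of the line (open sub-stubs), not claims. -/

/-- **Interface N2 (covariance form) — the one-scale expansion of the deep kernel COVARIANCE, uniformly over crude-good data.**  For
`β ≥ β₀` and every crude-good `ω` there are one-colour Dirichlet data `ϑ c` and competitors `s c` of total energy `≤ 16(2H+3)⁴β^{2δ-1}` with
`|β²·Cov_ω(c_p, c_q) − (3/2)·C_D(p,q)² − 2β·(Σ_c F̄_c(p)F̄_c(q))·C_D(p,q)| ≤ β^{-θ/2}`, `p = (boxCentre H; 1,2)`, `q = p + ⌈β^A⌉e₀`,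
`C_D = boxDirProjKernel H p q`, `F̄_c = sCirc (glue (ϑ c) (mean (ϑ c)))` (Wick: `Cov(½t_p², ½t_q²) = ½C_D²` per colour; the cross term
`2β F̄_pF̄_q Cov(t_p,t_q)`; odd moments vanish).  A POSIT of the line (open), not a claim and not a literature fact. -/
def KernelCovExpansion (A θ δ : ℝ) : Prop :=
  ∃ β₀ : ℝ, ∀ β : ℝ, β₀ ≤ β → ∀ ω : LGConfig 4 (Matrix.specialUnitaryGroup (Fin 2) ℂ), CrudeGood β δ ⌈β ^ θ⌉₊ ω →
    ∃ ϑ : Fin 3 → (Literature.MathematicalPhysics.QuantumLattice.ZdEdge 4 → ℝ), ∃ s : Fin 3 → (DirFree ⌈β ^ θ⌉₊ → ℝ),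
      (∑ c, LatticeMaxwell.formM (fun e => e ∉ dirFreeEdges ⌈β ^ θ⌉₊) dirCorner (2 * ⌈β ^ θ⌉₊ + 3) (ϑ c) (s c) ≤
          16 * (2 * (⌈β ^ θ⌉₊ : ℝ) + 3) ^ 4 * β ^ (2 * δ - 1)) ∧
      |β ^ 2 * ((∫ U, plaqCostAt (fundamentalRep (Fin 2)) (boxCentre ⌈β ^ θ⌉₊) 1 2 U *
              plaqCostAt (fundamentalRep (Fin 2)) (boxCentre ⌈β ^ θ⌉₊ + Pi.single 0 (⌈β ^ A⌉₊ : ℤ)) 1 2 U ∂(boxKernel β ⌈β ^ θ⌉₊ ω)) -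
            (∫ U, plaqCostAt (fundamentalRep (Fin 2)) (boxCentre ⌈β ^ θ⌉₊) 1 2 U ∂(boxKernel β ⌈β ^ θ⌉₊ ω)) *
              (∫ U, plaqCostAt (fundamentalRep (Fin 2)) (boxCentre ⌈β ^ θ⌉₊ + Pi.single 0 (⌈β ^ A⌉₊ : ℤ)) 1 2 U
                ∂(boxKernel β ⌈β ^ θ⌉₊ ω))) -
          3 / 2 * boxDirProjKernel ⌈β ^ θ⌉₊ (boxCentre ⌈β ^ θ⌉₊, 1, 2) (boxCentre ⌈β ^ θ⌉₊ + Pi.single 0 (⌈β ^ A⌉₊ : ℤ), 1, 2) ^ 2 -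
          2 * β * (∑ c,
              LatticeMaxwell.sCirc (LatticeMaxwell.glue (pin := fun e => e ∉ dirFreeEdges ⌈β ^ θ⌉₊) dirCorner (2 * ⌈β ^ θ⌉₊ + 3)
                  (ϑ c) (LatticeMaxwell.mean (fun e => e ∉ dirFreeEdges ⌈β ^ θ⌉₊) dirCorner (2 * ⌈β ^ θ⌉₊ + 3) (ϑ c)))
                (boxCentre ⌈β ^ θ⌉₊, 1, 2) *
              LatticeMaxwell.sCirc (LatticeMaxwell.glue (pin := fun e => e ∉ dirFreeEdges ⌈β ^ θ⌉₊) dirCorner (2 * ⌈β ^ θ⌉₊ + 3)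
                  (ϑ c) (LatticeMaxwell.mean (fun e => e ∉ dirFreeEdges ⌈β ^ θ⌉₊) dirCorner (2 * ⌈β ^ θ⌉₊ + 3) (ϑ c)))
                (boxCentre ⌈β ^ θ⌉₊ + Pi.single 0 (⌈β ^ A⌉₊ : ℤ), 1, 2)) *
            boxDirProjKernel ⌈β ^ θ⌉₊ (boxCentre ⌈β ^ θ⌉₊, 1, 2) (boxCentre ⌈β ^ θ⌉₊ + Pi.single 0 (⌈β ^ A⌉₊ : ℤ), 1, 2)|
        ≤ β ^ (-(θ / 2))

/-- **Interface N2 (flat covariance form) — the sibling crux's S3c in Dirichlet dress**: for the FLAT datum the cold-wall two-plaquette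
covariance is the Dirichlet Gaussian value with NO background, `|β²·boxPlaqCov β H ⌈β^A⌉ − (3/2)·C_D(p,q)²| ≤ β^{-θ/2}` for `β ≥ β₀`
(`(3/2)·C_D² = ¾·boxDirCircSqCov` by Wick, cf. `stub_boxGaussianDomination` / the lead's v7 `stub_boxDirichletDominationAbs` of crux
`ColdBoxTwoPointFloorW`).  A POSIT of the line (open), not a claim and not a literature fact. -/
def FlatCovExpansion (A θ : ℝ) : Prop :=
  ∃ β₀ : ℝ, ∀ β : ℝ, β₀ ≤ β →
    |β ^ 2 * boxPlaqCov (fundamentalRep (Fin 2)) β ⌈β ^ θ⌉₊ ⌈β ^ A⌉₊ -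
        3 / 2 * boxDirProjKernel ⌈β ^ θ⌉₊ (boxCentre ⌈β ^ θ⌉₊, 1, 2) (boxCentre ⌈β ^ θ⌉₊ + Pi.single 0 (⌈β ^ A⌉₊ : ℤ), 1, 2) ^ 2|
      ≤ β ^ (-(θ / 2))

/-- **Interface N1 (two-point form) — the Dirichlet curvature kernel at depth `T = ⌈β^A⌉ ≪ H = ⌈β^θ⌉` is of Coulomb size**: there is
`κ′ > 0` with `κ′/T⁴ ≤ C_D(p, p + Te₀) ≤ 1` for `β ≥ β₀` (lower: the Dirichlet twin of `exists_boxProjKernel_sub_curl_bound`, `K/H⁴ ≪ κ/T⁴`,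
+ FLOOR `curvatureCorrPowerFloor_proof` + positivity of `C(T) = T⁻⁴/π² + O(T⁻⁵)`; upper: Cauchy–Schwarz and `integral_dirCirc_sq_le_one`).
A POSIT of the line (open), not a claim and not a literature fact. -/
def DirKernelTwoPoint (A θ : ℝ) : Prop :=
  ∃ κ' : ℝ, 0 < κ' ∧ ∃ β₀ : ℝ, ∀ β : ℝ, β₀ ≤ β →
    κ' / (⌈β ^ A⌉₊ : ℝ) ^ 4 ≤
        boxDirProjKernel ⌈β ^ θ⌉₊ (boxCentre ⌈β ^ θ⌉₊, 1, 2) (boxCentre ⌈β ^ θ⌉₊ + Pi.single 0 (⌈β ^ A⌉₊ : ℤ), 1, 2) ∧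
      boxDirProjKernel ⌈β ^ θ⌉₊ (boxCentre ⌈β ^ θ⌉₊, 1, 2) (boxCentre ⌈β ^ θ⌉₊ + Pi.single 0 (⌈β ^ A⌉₊ : ℤ), 1, 2) ≤ 1

end Summit.QuantumFields.YangMills.Theorems.WeakCouplingRates
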